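import Summits.QuantumFields.YangMills.Theorems.BalabanLadderNTClassicalShadowReflectionAxis
import Summits.QuantumFields.YangMills.Theorems.BalabanLadderNTBoundaryLawCore
import HarnessLib

/-!
# Crux `NT` (stmt-QuantumFields-19353), stub `stub_refpkgT : RefPkgT`: THE CLASSICAL SHADOW, VIII — MIDPLANE reflections of an ARBITRARY
# cube `(c, b)` (even sides included): kernel covariance for every exterior, and the orbit-test symmetry (S), plain and up to gauge

Helper file (`--supports stmt-QuantumFields-19353`) of the fleet lead prover of crux `NT` (unit `ym-spine-19353-p1`, GEN 15); sequel of
`…ClassicalShadowReflection[Centred|Axis]` (p604593, p604990, p605202) and `…BoundaryLawCore` (`kerE_configShift`).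

WHY.  The landed reflection symmetries (S) cover cubes of ODD side `2R+1` centred at a site of the reflecting hyperplane.  The classical
programme's frustrated boxes (lead g14 kit j298039–j298557, this generation's j301533–j301540) are the cubes `[0,b)⁴` with `b = 4, 5, 6, 8, 10`,
whose symmetries are the MIDPLANE reflections `x_k ↦ 2c_k + b − 1 − x_k` — for even `b` a reflection about a half-integer hyperplane, i.e.
`Θ` followed by a lattice translation.  This file supplies them for every cube:

* §1 `timeFlip c b` (base of the time-reflected cube), `reflectEdge_mem_cubeEdges_timeFlip`, `cubeEdges_map_reflectEdge_timeFlip`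
  (`θ(cubeEdges c b) = cubeEdges (timeFlip c b) b`);
* §2 **`kerE_cfgReflect_timeFlip`** — reflection COVARIANCE of the cube kernels for EVERY exterior: `kerE^{Θη}_{timeFlip c b, b}(F) =
  kerE^η_{c,b}(F ∘ Θ)` (the symmetric special case was `kerE_cfgReflect_symm`);
* §3 the midplane time reflection of the cube, `boxTimeReflect c b := configShift ((2c₀+b−1)e₀) ∘ Θ` (continuous), its covariance
  **`kerE_boxTimeReflect`**: `kerE^{Rη}_{c,b}(F) = kerE^η_{c,b}(F ∘ R)` for every `η`, and (S): **`kerE_boxTimeReflect_symm`** (`Rη = η`),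
  **`kerE_boxTimeReflect_gauge_symm`** (`Rη = g·η`, gauge-invariant continuous `F` — the non-abelian coherent exterior is symmetric only up to
  a global colour rotation);
* §4 the midplane reflection of ANY axis `k`, `boxAxisReflect k c b := σ_{0k} ∘ boxTimeReflect (σ_{0k} c) b ∘ σ_{0k}`: **`kerE_boxAxisReflect`**,
  **`kerE_boxAxisReflect_symm`**, `kerE_boxAxisReflect_gauge_symm`.

With `kerE_perm[_gauge]_symm_fun` (coordinate permutations) and these, hypothesis (S) of the orbit test (`tendsto_kerCov_of_orbit`,
`orbitCov_le_of_e2osc[_depthOne]`, `ClassicalOrbitCovFloorUnbounded`) is a tree theorem for the full hyperoctahedral stabiliser of every cube,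
exactly or up to gauge; what remains hypothesis in the classical kill-path of clause 2 is variational only (ground states = one orbit; the
contrast along `b → ∞`).

HONEST FRAMING.  Symmetry bookkeeping over tree theorems (`ymSpecification_map_cfgReflect`, `kerE_configShift`, `kerE_perm`,
`kerE_gaugeTransformZd`); nothing about ground states, no floor, not AF, not NT, not the seam, not the gap; not Clay.
-/

set_option autoImplicit false

noncomputable section

open MeasureTheory Filter Topology
open Literature.MathematicalPhysics.QuantumFieldTheory Literature.MathematicalPhysics.QuantumLattice
open Literature.Probability.LatticeModels
open Summit.QuantumFields.YangMills.Cruxes.OSLegsFromFemtoAndGap.DlrCollarTransfer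
open Summit.QuantumFields.YangMills.Cruxes.OSLegsFromFemtoAndGap.DlrCollarTransfer.StubLower (mem_cubeSites_iff)

namespace Summit.QuantumFields.YangMills.Cruxes.NT.ClassicalShadow

/-! ## §1 The time reflection maps the interior edges of a cube onto those of the time-flipped cube -/

section Geometry

/-- Base of the time-reflected cube: `θ` maps the sites of the cube `(c, b)` onto the sites of the cube `(timeFlip c b, b)`,
`(timeFlip c b) 0 = 1 − b − c 0`, the other coordinates unchanged. -/
def timeFlip (c : Fin 4 → ℤ) (b : ℕ) : Fin 4 → ℤ :=
  Function.update c 0 (1 - b - c 0)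

/-- `timeFlip` at the time coordinate. [folklore] -/
@[simp] theorem timeFlip_zero (c : Fin 4 → ℤ) (b : ℕ) : timeFlip c b 0 = 1 - b - c 0 := by
  simp [timeFlip]

/-- `timeFlip` at a spatial coordinate. [folklore] -/
@[simp] theorem timeFlip_of_ne (c : Fin 4 → ℤ) (b : ℕ) {j : Fin 4} (hj : j ≠ 0) : timeFlip c b j = c j := by
  simp [timeFlip, hj]

/-- `timeFlip` is an involution. [folklore] -/
theorem timeFlip_timeFlip (c : Fin 4 → ℤ) (b : ℕ) : timeFlip (timeFlip c b) b = c := by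
  funext j
  by_cases hj : j = 0
  · subst hj; simp only [timeFlip_zero]; ring
  · simp only [timeFlip_of_ne _ _ hj]

/-- Translating the time-flipped base by `(2c₀ + b − 1)e₀` gives back the base. [folklore] -/
theorem timeFlip_add_single (c : Fin 4 → ℤ) (b : ℕ) : timeFlip c b + Pi.single 0 (2 * c 0 + b - 1) = c := by
  funext j
  by_cases hj : j = 0
  · subst hj; simp only [Pi.add_apply, timeFlip_zero, Pi.single_eq_same]; ring
  · simp only [Pi.add_apply, timeFlip_of_ne _ _ hj, Pi.single_eq_of_ne hj, add_zero]

/-- **The time reflection maps interior edges of the cube `(c, b)` to interior edges of the cube `(timeFlip c b, b)`.** [folklore] -/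
theorem reflectEdge_mem_cubeEdges_timeFlip {c : Fin 4 → ℤ} {b : ℕ} {e : Literature.MathematicalPhysics.QuantumLattice.ZdEdge 4}
    (he : e ∈ cubeEdges c b) : reflectEdge e ∈ cubeEdges (timeFlip c b) b := by
  obtain ⟨y, i⟩ := e
  rw [mem_cubeEdges_iff', mem_cubeSites_iff, mem_cubeSites_iff] at he ⊢
  obtain ⟨h1, h2⟩ := he
  dsimp only at h1 h2 ⊢
  by_cases hi : i = 0
  · subst hi
    simp only [reflectEdge, ↓reduceIte, sub_add_cancel]
    refine ⟨fun j => ?_, fun j => ?_⟩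
    · by_cases hj : j = 0
      · subst hj
        have a := h1 0; have b2 := h2 0
        simp only [Pi.add_apply, Pi.single_eq_same] at b2
        simp only [Pi.sub_apply, siteReflect_apply_zero, Pi.single_eq_same, timeFlip_zero]
        constructor <;> omega
      · have a := h1 j
        simp only [Pi.sub_apply, siteReflect_apply_of_ne _ hj, Pi.single_eq_of_ne hj, sub_zero, timeFlip_of_ne _ _ hj]
        exact a
    · by_cases hj : j = 0
      · subst hj
        have a := h1 0
        simp only [siteReflect_apply_zero, timeFlip_zero]
        constructor <;> omega
      · have a := h1 j
        simp only [siteReflect_apply_of_ne _ hj, timeFlip_of_ne _ _ hj]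
        exact a
  · simp only [reflectEdge, hi, ↓reduceIte]
    refine ⟨fun j => ?_, fun j => ?_⟩
    · by_cases hj : j = 0
      · subst hj
        have a := h1 0
        simp only [siteReflect_apply_zero, timeFlip_zero]
        constructor <;> omega
      · simp only [siteReflect_apply_of_ne _ hj, timeFlip_of_ne _ _ hj]
        exact h1 j
    · rw [← siteReflect_add_single_of_ne _ hi]
      by_cases hj : j = 0
      · subst hj
        have a := h2 0
        simp only [siteReflect_apply_zero, Pi.add_apply, Pi.single_eq_of_ne (Ne.symm hi), add_zero, timeFlip_zero]
        simp only [Pi.add_apply, Pi.single_eq_of_ne (Ne.symm hi), add_zero] at a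
        constructor <;> omega
      · simp only [siteReflect_apply_of_ne _ hj, timeFlip_of_ne _ _ hj]
        exact h2 j

/-- **`θ(cubeEdges c b) = cubeEdges (timeFlip c b) b`** for every cube. [folklore] -/
theorem cubeEdges_map_reflectEdge_timeFlip (c : Fin 4 → ℤ) (b : ℕ) :
    (cubeEdges c b).map reflectEdge_involutive.toPerm.toEmbedding = cubeEdges (timeFlip c b) b := by
  ext e
  rw [Finset.mem_map_equiv, Function.Involutive.toPerm_symm, Function.Involutive.coe_toPerm]
  constructor
  · intro h
    have h' := reflectEdge_mem_cubeEdges_timeFlip h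
    rwa [reflectEdge_reflectEdge] at h'
  · intro h
    have h' := reflectEdge_mem_cubeEdges_timeFlip h
    rwa [timeFlip_timeFlip] at h'

end Geometry

/-! ## §2 Reflection covariance of the cube kernels for EVERY exterior -/

section Covariance

variable {G : Type} [Group G] [TopologicalSpace G] [IsTopologicalGroup G] [CompactSpace G]
  [MeasurableSpace G] [BorelSpace G] (r : LatticeRep G)

/-- **`kerE^{Θη}_{timeFlip c b, b}(F) = kerE^η_{c,b}(F ∘ Θ)`** for every exterior `η` and every measurable `F`: the time reflection carries
the kernel of the cube `(c, b)` with exterior `η` to the kernel of the reflected cube with the reflected exterior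
(`ymSpecification_map_cfgReflect`). [folklore] -/
theorem kerE_cfgReflect_timeFlip (β : ℝ) (c : Fin 4 → ℤ) (b : ℕ) (η : LGConfig 4 G) {F : LGConfig 4 G → ℝ} (hF : Measurable F) :
    kerE G r β (timeFlip c b) b (cfgReflect η) F = kerE G r β c b η (F ∘ cfgReflect) := by
  unfold kerE
  rw [← cubeEdges_map_reflectEdge_timeFlip, integral_ymSpecification_cfgReflect r β (cubeEdges c b) η hF]

/-! ## §3 The midplane time reflection of a cube -/

/-- **Midplane time reflection of the cube `(c, b)`** on configurations: `Θ` followed by the translation by `(2c₀ + b − 1)e₀`, which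
brings the reflected cube back onto `(c, b)` (sites: `x₀ ↦ 2c₀ + b − 1 − x₀`; for even `b` a reflection about a half-integer hyperplane). -/
def boxTimeReflect (c : Fin 4 → ℤ) (b : ℕ) (U : LGConfig 4 G) : LGConfig 4 G :=
  Literature.MathematicalPhysics.QuantumLattice.configShift (Pi.single 0 (2 * c 0 + b - 1)) (cfgReflect U)

omit [IsTopologicalGroup G] [CompactSpace G] [BorelSpace G] in
/-- The midplane time reflection is continuous. [folklore] -/
theorem continuous_boxTimeReflect [ContinuousInv G] (c : Fin 4 → ℤ) (b : ℕ) : Continuous (boxTimeReflect (G := G) c b) := by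
  have hΘ : Continuous (cfgReflect (G := G)) := by
    refine continuous_pi fun e => ?_
    by_cases h : e.2 = 0
    · simp only [cfgReflect, if_pos h]
      exact (continuous_apply _).inv
    · simp only [cfgReflect, if_neg h]
      exact continuous_apply _
  have hS : Continuous (Literature.MathematicalPhysics.QuantumLattice.configShift (G := G) (Pi.single (0 : Fin 4) (2 * c 0 + (b : ℤ) - 1))) := by
    refine continuous_pi fun e => ?_
    simp only [Literature.MathematicalPhysics.QuantumLattice.configShift_apply]
    exact continuous_apply _
  exact hS.comp hΘ

omit [CompactSpace G] in
/-- The midplane time reflection is measurable. [folklore] -/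
theorem measurable_boxTimeReflect (c : Fin 4 → ℤ) (b : ℕ) : Measurable (boxTimeReflect (G := G) c b) :=
  (Literature.MathematicalPhysics.QuantumLattice.configShift (G := G) (Pi.single (0 : Fin 4) (2 * c 0 + (b : ℤ) - 1))).measurable.comp measurable_cfgReflect

/-- **Covariance of the cube kernels under the midplane time reflection, for EVERY exterior**:
`kerE^{Rη}_{c,b}(F) = kerE^η_{c,b}(F ∘ R)`, `R = boxTimeReflect c b`. [folklore] -/
theorem kerE_boxTimeReflect (β : ℝ) (c : Fin 4 → ℤ) (b : ℕ) (η : LGConfig 4 G) {F : LGConfig 4 G → ℝ} (hF : Measurable F) :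
    kerE G r β c b (boxTimeReflect c b η) F = kerE G r β c b η (F ∘ boxTimeReflect c b) := by
  have h1 := Summit.QuantumFields.YangMills.Cruxes.NT.BoundaryLaw.kerE_configShift G r (Pi.single 0 (2 * c 0 + (b : ℤ) - 1)) β
    (timeFlip c b) b (cfgReflect η) F
  rw [timeFlip_add_single] at h1
  have h2 := kerE_cfgReflect_timeFlip r β c b η (F := F ∘ Literature.MathematicalPhysics.QuantumLattice.configShift (Pi.single (0 : Fin 4) (2 * c 0 + (b : ℤ) - 1)))
    (hF.comp (Literature.MathematicalPhysics.QuantumLattice.configShift (G := G) (Pi.single (0 : Fin 4) (2 * c 0 + (b : ℤ) - 1))).measurable)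
  exact h1.trans h2

/-- **(S) for the midplane time reflection**: an `R`-invariant exterior has an `R`-invariant kernel, `kerE^η(F ∘ R) = kerE^η(F)`, on every
cube (odd or even side). [folklore] -/
theorem kerE_boxTimeReflect_symm (β : ℝ) {c : Fin 4 → ℤ} {b : ℕ} {η : LGConfig 4 G} (hη : boxTimeReflect c b η = η)
    {F : LGConfig 4 G → ℝ} (hF : Measurable F) :
    kerE G r β c b η (F ∘ boxTimeReflect c b) = kerE G r β c b η F := by
  rw [← kerE_boxTimeReflect r β c b η hF, hη]

/-- **(S) up to gauge**: if `R η` is a gauge transform of `η` then `kerE^η(F ∘ R) = kerE^η(F)` for every continuous gauge-invariant `F`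
(`kerE_gaugeTransformZd`). [folklore] -/
theorem kerE_boxTimeReflect_gauge_symm (β : ℝ) {c : Fin 4 → ℤ} {b : ℕ} {η : LGConfig 4 G} {g : Site 4 → G}
    (hη : boxTimeReflect c b η = gaugeTransformZd g η) {F : LGConfig 4 G → ℝ} (hF : Continuous F) (hFg : IsZdGaugeInvariant F) :
    kerE G r β c b η (F ∘ boxTimeReflect c b) = kerE G r β c b η F := by
  haveI : SecondCountableTopology G := (Continuous.isClosedEmbedding r.continuous r.injective).isEmbedding.secondCountableTopology
  rw [← kerE_boxTimeReflect r β c b η hF.measurable, hη, kerE_gaugeTransformZd r β c b η g hF.measurable]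
  congr 1
  funext U
  exact hFg g U

/-! ## §4 The midplane reflection of any axis -/

/-- **Midplane reflection of axis `k` of the cube `(c, b)`**: conjugate the midplane time reflection of the swapped cube by the coordinate
swap `0 ↔ k` (sites: `x_k ↦ 2c_k + b − 1 − x_k`). -/
def boxAxisReflect (k : Fin 4) (c : Fin 4 → ℤ) (b : ℕ) (U : LGConfig 4 G) : LGConfig 4 G :=
  relabelConfig (edgePerm (Equiv.swap 0 k)) (boxTimeReflect (sitePerm (Equiv.swap 0 k) c) b (relabelConfig (edgePerm (Equiv.swap 0 k)) U))

omit [IsTopologicalGroup G] [CompactSpace G] [BorelSpace G] in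
/-- The midplane axis reflection is continuous. [folklore] -/
theorem continuous_boxAxisReflect [ContinuousInv G] (k : Fin 4) (c : Fin 4 → ℤ) (b : ℕ) :
    Continuous (boxAxisReflect (G := G) k c b) := by
  have hσ : Continuous (relabelConfig (G := G) (edgePerm (Equiv.swap (0 : Fin 4) k))) := by
    refine continuous_pi fun e => ?_
    simp only [relabelConfig_apply]
    exact continuous_apply _
  exact hσ.comp ((continuous_boxTimeReflect _ _).comp hσ)

omit [CompactSpace G] in
/-- The midplane axis reflection is measurable. [folklore] -/
theorem measurable_boxAxisReflect (k : Fin 4) (c : Fin 4 → ℤ) (b : ℕ) : Measurable (boxAxisReflect (G := G) k c b) :=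
  (relabelConfig (edgePerm (Equiv.swap (0 : Fin 4) k))).measurable.comp
    ((measurable_boxTimeReflect _ _).comp (relabelConfig (edgePerm (Equiv.swap (0 : Fin 4) k))).measurable)

omit [MeasurableSpace G] in
/-- The swap of coordinates is an involution on cube bases. [folklore] -/
theorem sitePerm_swap_swap (i j : Fin 4) (c : Fin 4 → ℤ) : sitePerm (Equiv.swap i j) (sitePerm (Equiv.swap i j) c) = c := by
  funext m
  simp only [sitePerm_apply, Equiv.symm_swap, Equiv.swap_apply_self]

/-- **Covariance of the cube kernels under the midplane reflection of axis `k`, for EVERY exterior**: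
`kerE^{R_k η}_{c,b}(F) = kerE^η_{c,b}(F ∘ R_k)`. [folklore] -/
theorem kerE_boxAxisReflect (β : ℝ) (k : Fin 4) (c : Fin 4 → ℤ) (b : ℕ) (η : LGConfig 4 G) {F : LGConfig 4 G → ℝ} (hF : Measurable F) :
    kerE G r β c b (boxAxisReflect k c b η) F = kerE G r β c b η (F ∘ boxAxisReflect k c b) := by
  set σ : Equiv.Perm (Fin 4) := Equiv.swap 0 k with hσ
  set c₁ : Fin 4 → ℤ := sitePerm σ c with hc₁
  have hc : sitePerm σ c₁ = c := by rw [hc₁, hσ, sitePerm_swap_swap]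
  have hSm : Measurable (relabelConfig (G := G) (edgePerm σ)) := (relabelConfig (edgePerm σ)).measurable
  -- step 1: peel the outer relabelling
  have step1 := Summit.QuantumFields.YangMills.Cruxes.NT.BoundaryLaw.kerE_perm G r σ β c₁ b
    (boxTimeReflect c₁ b (relabelConfig (edgePerm σ) η)) F
  rw [hc] at step1
  -- step 2: the midplane time reflection of the swapped cube
  have step2 := kerE_boxTimeReflect r β c₁ b (relabelConfig (edgePerm σ) η) (F := F ∘ relabelConfig (edgePerm σ)) (hF.comp hSm)
  -- step 3: the inner relabelling
  have step3 := Summit.QuantumFields.YangMills.Cruxes.NT.BoundaryLaw.kerE_perm G r σ β c b η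
    ((F ∘ relabelConfig (edgePerm σ)) ∘ boxTimeReflect c₁ b)
  have hc' : sitePerm σ c = c₁ := hc₁.symm
  rw [hc'] at step3
  show kerE G r β c b (relabelConfig (edgePerm σ) (boxTimeReflect c₁ b (relabelConfig (edgePerm σ) η))) F = _
  rw [step1, step2, step3]
  rfl

/-- **(S) for the midplane reflection of axis `k`**: an `R_k`-invariant exterior has an `R_k`-invariant kernel on every cube. [folklore] -/
theorem kerE_boxAxisReflect_symm (β : ℝ) (k : Fin 4) {c : Fin 4 → ℤ} {b : ℕ} {η : LGConfig 4 G} (hη : boxAxisReflect k c b η = η)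
    {F : LGConfig 4 G → ℝ} (hF : Measurable F) :
    kerE G r β c b η (F ∘ boxAxisReflect k c b) = kerE G r β c b η F := by
  rw [← kerE_boxAxisReflect r β k c b η hF, hη]

/-- **(S) for the midplane reflection of axis `k`, up to gauge.** [folklore] -/
theorem kerE_boxAxisReflect_gauge_symm (β : ℝ) (k : Fin 4) {c : Fin 4 → ℤ} {b : ℕ} {η : LGConfig 4 G} {g : Site 4 → G}
    (hη : boxAxisReflect k c b η = gaugeTransformZd g η) {F : LGConfig 4 G → ℝ} (hF : Continuous F) (hFg : IsZdGaugeInvariant F) :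
    kerE G r β c b η (F ∘ boxAxisReflect k c b) = kerE G r β c b η F := by
  haveI : SecondCountableTopology G := (Continuous.isClosedEmbedding r.continuous r.injective).isEmbedding.secondCountableTopology
  rw [← kerE_boxAxisReflect r β k c b η hF.measurable, hη, kerE_gaugeTransformZd r β c b η g hF.measurable]
  congr 1
  funext U
  exact hFg g U

end Covariance

end Summit.QuantumFields.YangMills.Cruxes.NT.ClassicalShadow

end
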